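import Summits.QuantumFields.YangMills.Theorems.BalabanUVNodesN15BackgroundMatrixByPartsLayerTwoSided
import Summits.QuantumFields.YangMills.Theorems.BalabanUVNodesN15BackgroundLayerEntriesOfLetters
import HarnessLib

/-!
# THE TWO-SIDED BY-PARTS OPERATOR LAYER FROM EXPLICIT LETTERS — TRANSPORT-GENERIC: entry 2 by parts for ARBITRARY fine ∕ coarse matrix coefficient families `(C′, Â′)`,
# `(C, Â)` (no block-average transport assumed), the constant `bpConst2L` (dag-n15-c g9, FILE 23; Track-A node N15 = NE2, s1 «background-layer OPERATOR ingredient»)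

`--kind proof --supports stmt-QuantumFields-20544 --as helper` (K3⁷; count-neutral).  Imports BY NAME this seat's FILE 19 `…N15BackgroundMatrixByPartsLayerTwoSided` (`e2OpMBP₂`, through
it FILE 18's letters `hasMaj_byPartsMult_matrix₂` ∕ `hasMaj_idef_byPartsMult_matrix₂` ∕ `hasMaj_mmulOp_translate_fwd` ∕ `hasMaj_idef_mmulOp_translate_fwd`, FILE 12
`hasMaj_mmulOp_translate` ∕ `hasMaj_idef_mmulOp_translate`, FILE 3 ★★ `hasMaj_idef_entry2_of_letters`, FILE 7a `mKOf_mul` ∕ `mBOf_mul` ∕ `bgConst`, M1 `unstackM` ∕ `bgPairM` ∕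
`hasMaj_unstackM` ∕ `hasMaj_idef_unstackM`, B1a `hasMaj_bgPropV`) and this lineage's g2 V0 `…N15BackgroundLayerEntriesOfLetters` (★ `hasMaj_entries_of_letters`: the entries of the
dressed pair from the THREE perturbation letters, for ANY coarse partner); nothing in the tree is modified.

WHY.  FILES 13∕19 hard-wire the coarse partner of a matrix coefficient family as its ENTRYWISE block average (`avgM₁`) — the linearised (C3) transport.  For Bałaban's OWN species
(3.52) the coarse coefficients are the `ad`-polynomials OF THE COARSE GAUGE FIELD (nonlinear in the field: `F′(ad Ā) ≠ avg F′(ad A′)`), so the layer must accept an arbitrary coarse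
configuration with the fit letters stated between the two configurations.  This file restates FILE 19 ★★ in that generality; the sequel feeds it with the print's `V′₁(A)` coefficients
(g2 V1a `v1coefC` ∕ `v1coefA`) of a fine gauge field and of its block mean.

CONTENTS ([folklore] bookkeeping; 1 def).  `bpConst2L` (+ `_nonneg`), ★★ `hasMaj_entry2_byParts_matrix₂_of_letters`.

HONEST FRAMING.  Bookkeeping over tree theorems; the `U ≡ 1` layer and all coefficient letters DISPLAYED; nothing about Bałaban's `G(U)` asserted; NE2⁺ NOT PRINTED; N15 not
discharged; nothing continuum ∕ OS ∕ mass-gap ∕ Clay.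
-/

noncomputable section

open scoped BigOperators
open Finset

namespace Summit.QuantumFields.YangMills.BalabanUVNodes.N15.BackgroundLayer

open Literature.MathematicalPhysics.QuantumFieldTheory.Balaban1983to89
open Literature.MathematicalPhysics.QuantumFieldTheory.Balaban1983to89.B11SectG (BlockNorm HasMaj RowSum hasMaj_comp hasMaj_comp_exp hasMaj_zero)
open Literature.MathematicalPhysics.QuantumFieldTheory.Balaban1983to89.T4EtaRate (PairedInstance EtaPairing EtaRateIneq342 NE2PlusOperator rateFactor)
open Literature.MathematicalPhysics.QuantumFieldTheory.Balaban1983to89.T4EtaRateDefect (idef idef_apply idef_comp idef_zero rateWeight)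
open Literature.MathematicalPhysics.QuantumFieldTheory.Balaban1983to89.T4EtaRateCoeffDefect (pull pull_apply diagK diagK_nonneg FibreOsc blockAvg fit_blockAvg)
open Literature.MathematicalPhysics.QuantumFieldTheory.Balaban1983to89.B6RandomWalk (Triangle254)
open Literature.MathematicalPhysics.QuantumFieldTheory.Balaban1983to89.B9SectDSup (inv_one_sub_le_two)
open Summit.QuantumFields.YangMills.BalabanUVNodes.N15.OperatorReadout (opGeo opFamily)
open Summit.QuantumFields.YangMills.BalabanUVNodes.N15.MatrixSpecies (mmulOp mmulOp_apply liftEquiv liftMap liftBlk hasMaj_mmulOp hasMaj_idef_mmulOp)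
open Summit.QuantumFields.YangMills.BalabanUVNodes.N15.SiteLayer (hasMaj_exp_comp_diagK hasMaj_diagK_comp_exp hasMaj_add_exp hasMaj_exp_mono)

variable {d : ℕ}

/-! ## §1 The transport-generic entry-2 constant -/

section Const

/-- THE TRANSPORT-GENERIC TWO-SIDED ENTRY-2 CONSTANT at letter scale `a` (FILE 19's `bpConst2₂` with `c₃₅|ι| ↦ 1`, `a₀ ↦ a`). [folklore] -/
def bpConst2L (nJ nJ' β cr m₀ a cT mT : ℝ) : ℝ :=
  srcConst nJ β (β * 2) (a * (1 + nJ')) cr * (1 * (1 - 1 * rowConst nJ β cT a cr * cr * cr))⁻¹ *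
      mKOf nJ β cT a m₀ (a * (1 + nJ')) mT cr * cr * (1 * (1 - 1 * rowConst nJ β cT a cr * cr * cr))⁻¹ * cr * cr +
    mBOf nJ β (β * 2) (a * (1 + nJ')) cr m₀ (bgConst β cr m₀ (1 + nJ') a) (a * (1 + nJ')) * (1 * (1 - 1 * rowConst nJ β cT a cr * cr * cr))⁻¹ * cr

/-- It is non-negative for non-negative letters under the by-parts smallness. [folklore] -/
theorem bpConst2L_nonneg {nJ nJ' β cr m₀ a cT mT : ℝ} (hnJ : 0 ≤ nJ) (hnJ' : 0 ≤ nJ') (hβ : 0 ≤ β) (hcr : 0 ≤ cr) (hm₀ : 0 ≤ m₀) (ha : 0 ≤ a) (hcT : 0 ≤ cT)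
    (hmT : 0 ≤ mT) (hq : 1 * rowConst nJ β cT a cr * cr * cr < 1) : 0 ≤ bpConst2L nJ nJ' β cr m₀ a cT mT := by
  have hA : 0 ≤ (1 * (1 - 1 * rowConst nJ β cT a cr * cr * cr))⁻¹ := by
    rw [one_mul]; exact inv_nonneg.2 (by linarith)
  have h1 : 0 ≤ bgConst β cr m₀ (1 + nJ') a := bgConst_nonneg hβ hcr hm₀ (by positivity) ha
  unfold bpConst2L
  set A := (1 * (1 - 1 * rowConst nJ β cT a cr * cr * cr))⁻¹
  set B := bgConst β cr m₀ (1 + nJ') a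
  unfold srcConst mKOf mBOf
  positivity

end Const

/-! ## §2 Entry 2 by parts from explicit letters -/

section Entry2

variable {X X' J ι : Type} [Fintype X] [Fintype X'] [Fintype J] [Fintype ι] [DecidableEq X] [DecidableEq X'] [DecidableEq J] [DecidableEq ι]
  {g : B6.Geometry} (blk : X → g.Site) (π : X' → X)

variable {τ : J → X ≃ X} {τ' : J → X' ≃ X'} {n n' : ℝ} {G : (X × ι → ℝ) →ₗ[ℝ] (X × ι → ℝ)} {D : J ⊕ J → (X × ι → ℝ) →ₗ[ℝ] (X × ι → ℝ)}
  {G' : (X' × ι → ℝ) →ₗ[ℝ] (X' × ι → ℝ)} {D' : J ⊕ J → (X' × ι → ℝ) →ₗ[ℝ] (X' × ι → ℝ)}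
set_option maxHeartbeats 400000 in
/-- ★★ **ENTRY 2 OF THE TWO-SIDED NON-ABELIAN FIRST-ORDER PAIR, BY PARTS, FROM EXPLICIT LETTERS (transport-generic).**  As FILE 19 ★★, but the fine configuration
`(C′, Â′)` and the COARSE configuration `(C, Â)` are ARBITRARY matrix coefficient families (no block-average transport is assumed) and the hypotheses are the LETTERS themselves at a
scale `a ≥ 0`: row sums of `C, Â_ĵ, C′, Â′_ĵ` (`≤ a`), row fits `C′ − C∘π`, `Â′_ĵ − Â_ĵ∘π` (`≤ aθ`), gradient rows of the forward ∕ backward coefficients at both spacings (`≤ a`), the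
forward translated fit along `e⁻¹`, the translated derivative fit, the backward translated fit along `e`, the untranslated backward derivative fit (all `≤ aθ`; the coarse
one-step oscillation is only needed to PRODUCE the shift-defect row letter, which is displayed here); the guards `β((1+|J ⊕ J|)a)c_r ≤ ½`, `rowConst(|J|, β, c_T, a, c_r)c_r² ≤ ½`; the `U ≡ 1` layer and the shift-defect row letter as in FILE 19.  CONCLUSION:
`𝔇(E₂′, E₂)∘ι_ν ≤ bpConst2L(|J|, |J ⊕ J|, β, c_r, m₀, a, c_T, m_T)·θ·e^{−(δ−6σ)d}`.  Entries 0 of the dressed pair enter through g2 V0 `hasMaj_entries_of_letters` (three perturbation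
letters: M1 `hasMaj_unstackM` ∕ `hasMaj_idef_unstackM`), the rest is FILE 3 ★★ with FILE 18's letters. [cite: Balaban1985BackgroundPropagators, Thm 3.1 (3.42) p.397 (entry «G(U)∇*»: shape) + (3.52) p.400 + (3.64)–(3.65) p.402 (mechanism)] -/
theorem hasMaj_entry2_byParts_matrix₂_of_letters (htri : Triangle254 g) (hd : ∀ a b : g.Site, 0 ≤ g.dist a b) (hd0 : ∀ y : g.Site, g.dist y y = 0) {σ cr : ℝ} (hσ : 0 ≤ σ)
    (hcr : 0 ≤ cr) (hrow : RowSum g σ cr) {δ β m₀ θ a cT mT : ℝ} (hσδ : 6 * σ ≤ δ) (hβ : 0 ≤ β) (hm₀ : 0 ≤ m₀) (hθ : 0 ≤ θ) (ha : 0 ≤ a)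
    (hq : β * ((1 + Fintype.card (J ⊕ J)) * a) * cr ≤ 1 / 2) (hcT : 0 ≤ cT) (hmT : 0 ≤ mT) (hq2 : 1 * rowConst (Fintype.card J) β cT a cr * cr * cr ≤ 1 / 2)
    (hG : HasMaj (BlockNorm.ofBlocks g (liftBlk blk ι)) (BlockNorm.ofBlocks g (liftBlk blk ι)) G (fun y y' => β * Real.exp (-(δ * g.dist y y'))))
    (hD : ∀ μ, HasMaj (BlockNorm.ofBlocks g (liftBlk blk ι)) (BlockNorm.ofBlocks g (liftBlk blk ι)) (D μ) (fun y y' => β * Real.exp (-(δ * g.dist y y'))))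
    (hG' : HasMaj (BlockNorm.ofBlocks g (liftBlk (blk ∘ π) ι)) (BlockNorm.ofBlocks g (liftBlk (blk ∘ π) ι)) G' (fun y y' => β * Real.exp (-(δ * g.dist y y'))))
    (hD' : ∀ μ, HasMaj (BlockNorm.ofBlocks g (liftBlk (blk ∘ π) ι)) (BlockNorm.ofBlocks g (liftBlk (blk ∘ π) ι)) (D' μ)
      (fun y y' => β * Real.exp (-(δ * g.dist y y'))))
    (hDG : HasMaj (BlockNorm.ofBlocks g (liftBlk blk ι)) (BlockNorm.ofBlocks g (liftBlk (blk ∘ π) ι)) (idef (pull (liftMap π ι)) (pull (liftMap π ι)) G' G)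
      (fun y y' => m₀ * θ * Real.exp (-(δ * g.dist y y'))))
    (hDD : ∀ μ, HasMaj (BlockNorm.ofBlocks g (liftBlk blk ι)) (BlockNorm.ofBlocks g (liftBlk (blk ∘ π) ι))
      (idef (pull (liftMap π ι)) (pull (liftMap π ι)) (D' μ) (D μ)) (fun y y' => m₀ * θ * Real.exp (-(δ * g.dist y y'))))
    (hS : ∀ ν, HasMaj (BlockNorm.ofBlocks g (liftBlk blk ι)) (BlockNorm.ofBlocks g (liftBlk blk ι)) (G ∘ₗ fgradAdj n (liftEquiv (τ ν) ι))
      (fun y y' => β * Real.exp (-(δ * g.dist y y'))))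
    (hS' : ∀ ν, HasMaj (BlockNorm.ofBlocks g (liftBlk (blk ∘ π) ι)) (BlockNorm.ofBlocks g (liftBlk (blk ∘ π) ι)) (G' ∘ₗ fgradAdj n' (liftEquiv (τ' ν) ι))
      (fun y y' => β * Real.exp (-(δ * g.dist y y'))))
    (hDS : ∀ ν, HasMaj (BlockNorm.ofBlocks g (liftBlk blk ι)) (BlockNorm.ofBlocks g (liftBlk (blk ∘ π) ι))
      (idef (pull (liftMap π ι)) (pull (liftMap π ι)) (G' ∘ₗ fgradAdj n' (liftEquiv (τ' ν) ι)) (G ∘ₗ fgradAdj n (liftEquiv (τ ν) ι)))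
      (fun y y' => m₀ * θ * Real.exp (-(δ * g.dist y y'))))
    (hSh : ∀ μ, HasMaj (BlockNorm.ofBlocks g (liftBlk blk ι)) (BlockNorm.ofBlocks g (liftBlk blk ι)) (pull (liftEquiv (τ μ) ι))
      (fun y y' => cT * Real.exp (-(δ * g.dist y y'))))
    (hSh' : ∀ μ, HasMaj (BlockNorm.ofBlocks g (liftBlk (blk ∘ π) ι)) (BlockNorm.ofBlocks g (liftBlk (blk ∘ π) ι)) (pull (liftEquiv (τ' μ) ι))
      (fun y y' => cT * Real.exp (-(δ * g.dist y y'))))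
    {C : X → Matrix ι ι ℝ} {A : J ⊕ J → X → Matrix ι ι ℝ} {C' : X' → Matrix ι ι ℝ} {A' : J ⊕ J → X' → Matrix ι ι ℝ}
    (hc : ∀ x i, ∑ j, |C x i j| ≤ a) (hA : ∀ μ x i, ∑ j, |A μ x i j| ≤ a) (hc' : ∀ x' i, ∑ j, |C' x' i j| ≤ a) (hA' : ∀ μ x' i, ∑ j, |A' μ x' i j| ≤ a)
    (hfc : ∀ x' i, ∑ j, |C' x' i j - C (π x') i j| ≤ a * θ) (hfA : ∀ μ x' i, ∑ j, |A' μ x' i j - A μ (π x') i j| ≤ a * θ)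
    (hga : ∀ μ x i, ∑ j, |fgradMat n (τ μ) (A (Sum.inl μ)) x i j| ≤ a) (hga' : ∀ μ x' i, ∑ j, |fgradMat n' (τ' μ) (A' (Sum.inl μ)) x' i j| ≤ a)
    (hgb : ∀ μ x i, ∑ j, |fgradMat n (τ μ) (A (Sum.inr μ)) x i j| ≤ a) (hgb' : ∀ μ x' i, ∑ j, |fgradMat n' (τ' μ) (A' (Sum.inr μ)) x' i j| ≤ a)
    (hfaT : ∀ μ x' i, ∑ j, |A' (Sum.inl μ) ((τ' μ).symm x') i j - A (Sum.inl μ) ((τ μ).symm (π x')) i j| ≤ a * θ)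
    (hfgT : ∀ μ x' i, ∑ j, |fgradMat n' (τ' μ) (A' (Sum.inl μ)) ((τ' μ).symm x') i j - fgradMat n (τ μ) (A (Sum.inl μ)) ((τ μ).symm (π x')) i j| ≤ a * θ)
    (hfbT : ∀ μ x' i, ∑ j, |A' (Sum.inr μ) (τ' μ x') i j - A (Sum.inr μ) (τ μ (π x')) i j| ≤ a * θ)
    (hfgb : ∀ μ x' i, ∑ j, |fgradMat n' (τ' μ) (A' (Sum.inr μ)) x' i j - fgradMat n (τ μ) (A (Sum.inr μ)) (π x') i j| ≤ a * θ)
    (hDSh : ∀ μ, HasMaj (BlockNorm.ofBlocks g (liftBlk (liftBlk blk ι) J)) (BlockNorm.ofBlocks g (liftBlk (blk ∘ π) ι))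
      (idef (pull (liftMap π ι)) (pull (liftMap π ι)) (pull (liftEquiv (τ' μ) ι)) (pull (liftEquiv (τ μ) ι)) ∘ₗ
        (mmulOp (A (Sum.inl μ) ∘ ⇑(τ μ).symm) ∘ₗ sumJ fun ν => G ∘ₗ fgradAdj n (liftEquiv (τ ν) ι)))
      (fun y y' => mT * θ * Real.exp (-(δ * g.dist y y'))))
    (ν : J) :
    HasMaj (BlockNorm.ofBlocks g (liftBlk blk ι)) (BlockNorm.ofBlocks g (liftBlk (blk ∘ π) ι))
      (idef (pull (liftMap (liftMap π ι) J)) (pull (liftMap π ι)) (e2OpMBP₂ τ' n' G' D' C' A') (e2OpMBP₂ τ n G D C A) ∘ₗ injJ ν)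
      (fun y y' => bpConst2L (Fintype.card J) (Fintype.card (J ⊕ J)) β cr m₀ a cT mT * θ * Real.exp (-((δ - 6 * σ) * g.dist y y'))) := by
  have hnJ : (0 : ℝ) ≤ Fintype.card J := Nat.cast_nonneg _
  have hnJ2 : (0 : ℝ) ≤ Fintype.card (J ⊕ J) := Nat.cast_nonneg _
  have hJ2 : (Fintype.card (J ⊕ J) : ℝ) = Fintype.card J + Fintype.card J := by rw [Fintype.card_sum]; push_cast; ring
  have hJ0 : (0 : ℝ) ≤ 1 + Fintype.card (J ⊕ J) := by positivity
  have haθ : 0 ≤ a * θ := mul_nonneg ha hθ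
  have hσδ' : σ ≤ δ := by linarith
  -- (E₀′): the fine dressed propagator's majorant `≤ 2β·e^{−(δ−σ)d}`
  have hR0 : 0 ≤ a * (1 + Fintype.card (J ⊕ J)) := mul_nonneg ha hJ0
  have hq' : β * (a * (1 + Fintype.card (J ⊕ J))) * cr ≤ 1 / 2 := by rw [mul_comm a]; exact hq
  have hq1 : β * (a * (1 + Fintype.card (J ⊕ J))) * cr < 1 := by linarith
  have hinv : (1 - β * (a * (1 + Fintype.card (J ⊕ J))) * cr)⁻¹ ≤ 2 := inv_one_sub_le_two hq'
  have hV : HasMaj (BlockNorm.ofBlocks g (blkPair (liftBlk blk ι))) (BlockNorm.ofBlocks g (liftBlk blk ι)) (unstackM C A)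
      (diagK fun _ => a * (1 + Fintype.card (J ⊕ J))) := hasMaj_unstackM blk ha hc hA
  have hV' : HasMaj (BlockNorm.ofBlocks g (blkPair (liftBlk (blk ∘ π) ι))) (BlockNorm.ofBlocks g (liftBlk (blk ∘ π) ι)) (unstackM C' A')
      (diagK fun _ => a * (1 + Fintype.card (J ⊕ J))) := hasMaj_unstackM (blk ∘ π) ha hc' hA'
  have hDV : HasMaj (BlockNorm.ofBlocks g (blkPair (liftBlk blk ι))) (BlockNorm.ofBlocks g (liftBlk (blk ∘ π) ι))
      (idef (pull (liftPair (liftMap π ι))) (pull (liftMap π ι)) (unstackM C' A') (unstackM C A)) (diagK fun _ => a * (1 + Fintype.card (J ⊕ J)) * θ) :=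
    (hasMaj_idef_unstackM blk π haθ hfc hfA).mono fun y y' =>
      T4EtaRateCoeffDefect.diagK_mono (fun _ => (by ring : a * θ * (1 + (Fintype.card (J ⊕ J) : ℝ)) = a * (1 + Fintype.card (J ⊕ J)) * θ).le) y y'
  have hSG' := hasMaj_stack (liftBlk (blk ∘ π) ι) (fun _ _ => mul_nonneg hβ (Real.exp_nonneg _)) hG' hD'
  have hX' := hasMaj_bgPropV (liftBlk (blk ∘ π) ι) (blkPair (liftBlk (blk ∘ π) ι)) htri hd hrow hσ (ρ := δ - σ) (by linarith) (by linarith) hβ hR0 hSG' hV' hq1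
  have hE' : HasMaj (BlockNorm.ofBlocks g (liftBlk (blk ∘ π) ι)) (BlockNorm.ofBlocks g (liftBlk (blk ∘ π) ι)) (projO none ∘ₗ bgPairM G' D' C' A')
      (fun y y' => β * 2 * Real.exp (-((δ - σ) * g.dist y y'))) :=
    (hasMaj_projO_comp (liftBlk (blk ∘ π) ι) hX' none).mono fun y y' =>
      mul_le_mul_of_nonneg_right (mul_le_mul_of_nonneg_left hinv hβ) (Real.exp_nonneg _)
  -- (𝔇E₀): V0's entry 0 from the three perturbation letters (transport-generic; the mixed ∕ Laplacian slots fed with zeros)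
  have hz : ∀ {F₁ F₂ : Type} [AddCommGroup F₁] [Module ℝ F₁] [AddCommGroup F₂] [Module ℝ F₂] (b₁ : BlockNorm g F₁) (b₂ : BlockNorm g F₂) (c : ℝ), 0 ≤ c →
      HasMaj b₁ b₂ (0 : F₁ →ₗ[ℝ] F₂) (fun y y' => c * Real.exp (-(δ * g.dist y y'))) := fun b₁ b₂ c hc0 =>
    (hasMaj_zero b₁ b₂).mono fun _ _ => mul_nonneg hc0 (Real.exp_nonneg _)
  have hDE := (hasMaj_entries_of_letters (liftBlk blk ι) (liftMap π ι) htri hd hσ hcr hrow hσδ' hβ hm₀ hθ hJ0 ha hq hR0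
    (le_of_eq (by ring)) hG hD hG' hD' (hz _ _ β hβ) (S := 0) (SD := fun _ => 0) (S' := 0) (SD' := fun _ => 0) (D₃ := 0) (D₃' := 0) (fun _ => hz _ _ β hβ)
    (hz _ _ β hβ) hDG hDD (by rw [idef_zero]; exact hz _ _ (m₀ * θ) (mul_nonneg hm₀ hθ)) (fun _ => by rw [idef_zero]; exact hz _ _ (m₀ * θ) (mul_nonneg hm₀ hθ))
    (by rw [idef_zero]; exact hz _ _ (m₀ * θ) (mul_nonneg hm₀ hθ)) hV hV' hDV).1 none
  -- multiplier letters (FILE 18)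
  have hdiag : ∀ {t t' : ℝ}, t ≤ t' → ∀ y y' : g.Site, diagK (fun _ => t) y y' ≤ diagK (fun _ => t') y y' :=
    fun h y y' => T4EtaRateCoeffDefect.diagK_mono (fun _ => h) y y'
  have hrR : a + Fintype.card J * (a + a) ≤ a * (1 + Fintype.card (J ⊕ J)) := by rw [hJ2]; nlinarith
  have hR : HasMaj (BlockNorm.ofBlocks g (liftBlk blk ι)) (BlockNorm.ofBlocks g (liftBlk blk ι))
      (mmulOp (C - ∑ μ, (fgradMat n (τ μ) (A (Sum.inl μ)) ∘ ⇑(τ μ).symm + fgradMat n (τ μ) (A (Sum.inr μ))))) (diagK fun _ => a * (1 + Fintype.card (J ⊕ J))) :=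
    (hasMaj_byPartsMult_matrix₂ blk (A := fun μ => A (Sum.inl μ)) (B := fun μ => A (Sum.inr μ)) ha ha hc hga hgb).mono (hdiag hrR)
  have hR' : HasMaj (BlockNorm.ofBlocks g (liftBlk (blk ∘ π) ι)) (BlockNorm.ofBlocks g (liftBlk (blk ∘ π) ι))
      (mmulOp (C' - ∑ μ, (fgradMat n' (τ' μ) (A' (Sum.inl μ)) ∘ ⇑(τ' μ).symm + fgradMat n' (τ' μ) (A' (Sum.inr μ))))) (diagK fun _ => a * (1 + Fintype.card (J ⊕ J))) :=
    (hasMaj_byPartsMult_matrix₂ (blk ∘ π) (A := fun μ => A' (Sum.inl μ)) (B := fun μ => A' (Sum.inr μ)) ha ha hc' hga' hgb').mono (hdiag hrR)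
  have hoR : a * θ + Fintype.card J * (a * θ + a * θ) ≤ a * (1 + Fintype.card (J ⊕ J)) * θ := by rw [hJ2]; nlinarith [mul_nonneg hnJ haθ]
  have hDR : HasMaj (BlockNorm.ofBlocks g (liftBlk blk ι)) (BlockNorm.ofBlocks g (liftBlk (blk ∘ π) ι))
      (idef (pull (liftMap π ι)) (pull (liftMap π ι))
        (mmulOp (C' - ∑ μ, (fgradMat n' (τ' μ) (A' (Sum.inl μ)) ∘ ⇑(τ' μ).symm + fgradMat n' (τ' μ) (A' (Sum.inr μ)))))
        (mmulOp (C - ∑ μ, (fgradMat n (τ μ) (A (Sum.inl μ)) ∘ ⇑(τ μ).symm + fgradMat n (τ μ) (A (Sum.inr μ))))))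
      (diagK fun _ => a * (1 + Fintype.card (J ⊕ J)) * θ) :=
    (hasMaj_idef_byPartsMult_matrix₂ blk π (A := fun μ => A (Sum.inl μ)) (B := fun μ => A (Sum.inr μ)) (A' := fun μ => A' (Sum.inl μ)) (B' := fun μ => A' (Sum.inr μ))
      haθ hfc hfgT hfgb).mono (hdiag hoR)
  -- coefficient letters: forward (translated along `e⁻¹`) and backward (translated along `e`)
  have ha1 : a ≤ a := le_rfl
  have hCa : ∀ μ, HasMaj (BlockNorm.ofBlocks g (liftBlk blk ι)) (BlockNorm.ofBlocks g (liftBlk blk ι)) (mmulOp (A (Sum.inl μ) ∘ ⇑(τ μ).symm)) (diagK fun _ => a) :=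
    fun μ => hasMaj_mmulOp_translate blk (A := fun μ => A (Sum.inl μ)) ha (fun μ => hA (Sum.inl μ)) μ
  have hCa' : ∀ μ, HasMaj (BlockNorm.ofBlocks g (liftBlk (blk ∘ π) ι)) (BlockNorm.ofBlocks g (liftBlk (blk ∘ π) ι)) (mmulOp (A' (Sum.inl μ) ∘ ⇑(τ' μ).symm))
      (diagK fun _ => a) := fun μ => hasMaj_mmulOp_translate (blk ∘ π) (A := fun μ => A' (Sum.inl μ)) ha (fun μ => hA' (Sum.inl μ)) μ
  have hCb : ∀ μ, HasMaj (BlockNorm.ofBlocks g (liftBlk blk ι)) (BlockNorm.ofBlocks g (liftBlk blk ι)) (mmulOp (A (Sum.inr μ) ∘ ⇑(τ μ))) (diagK fun _ => a) :=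
    fun μ => hasMaj_mmulOp_translate_fwd blk (B := fun μ => A (Sum.inr μ)) ha (fun μ => hA (Sum.inr μ)) μ
  have hCb' : ∀ μ, HasMaj (BlockNorm.ofBlocks g (liftBlk (blk ∘ π) ι)) (BlockNorm.ofBlocks g (liftBlk (blk ∘ π) ι)) (mmulOp (A' (Sum.inr μ) ∘ ⇑(τ' μ)))
      (diagK fun _ => a) := fun μ => hasMaj_mmulOp_translate_fwd (blk ∘ π) (B := fun μ => A' (Sum.inr μ)) ha (fun μ => hA' (Sum.inr μ)) μ
  have hoa0 : a * θ ≤ a * (1 + Fintype.card (J ⊕ J)) * θ := by nlinarith [mul_nonneg (mul_nonneg ha hnJ2) hθ]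
  have hDCa : ∀ μ, HasMaj (BlockNorm.ofBlocks g (liftBlk blk ι)) (BlockNorm.ofBlocks g (liftBlk (blk ∘ π) ι))
      (idef (pull (liftMap π ι)) (pull (liftMap π ι)) (mmulOp (A' (Sum.inl μ) ∘ ⇑(τ' μ).symm)) (mmulOp (A (Sum.inl μ) ∘ ⇑(τ μ).symm)))
      (diagK fun _ => a * (1 + Fintype.card (J ⊕ J)) * θ) :=
    fun μ => (hasMaj_idef_mmulOp_translate blk π (A := fun μ => A (Sum.inl μ)) (A' := fun μ => A' (Sum.inl μ)) μ haθ (hfaT μ)).mono (hdiag hoa0)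
  have hDCb : ∀ μ, HasMaj (BlockNorm.ofBlocks g (liftBlk blk ι)) (BlockNorm.ofBlocks g (liftBlk (blk ∘ π) ι))
      (idef (pull (liftMap π ι)) (pull (liftMap π ι)) (mmulOp (A' (Sum.inr μ) ∘ ⇑(τ' μ))) (mmulOp (A (Sum.inr μ) ∘ ⇑(τ μ))))
      (diagK fun _ => a * (1 + Fintype.card (J ⊕ J)) * θ) :=
    fun μ => (hasMaj_idef_mmulOp_translate_fwd blk π (B := fun μ => A (Sum.inr μ)) (B' := fun μ => A' (Sum.inr μ)) μ haθ (hfbT μ)).mono (hdiag hoa0)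
  -- rate-lowered `U ≡ 1` letters at `δ − σ`
  have hS1 : ∀ ν, HasMaj (BlockNorm.ofBlocks g (liftBlk blk ι)) (BlockNorm.ofBlocks g (liftBlk blk ι)) (G ∘ₗ fgradAdj n (liftEquiv (τ ν) ι))
      (fun y y' => β * Real.exp (-((δ - σ) * g.dist y y'))) := fun ν => hasMaj_exp_mono hd hβ (by linarith) (hS ν)
  have hS1' : ∀ ν, HasMaj (BlockNorm.ofBlocks g (liftBlk (blk ∘ π) ι)) (BlockNorm.ofBlocks g (liftBlk (blk ∘ π) ι)) (G' ∘ₗ fgradAdj n' (liftEquiv (τ' ν) ι))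
      (fun y y' => β * Real.exp (-((δ - σ) * g.dist y y'))) := fun ν => hasMaj_exp_mono hd hβ (by linarith) (hS' ν)
  have hDS1 : ∀ ν, HasMaj (BlockNorm.ofBlocks g (liftBlk blk ι)) (BlockNorm.ofBlocks g (liftBlk (blk ∘ π) ι))
      (idef (pull (liftMap π ι)) (pull (liftMap π ι)) (G' ∘ₗ fgradAdj n' (liftEquiv (τ' ν) ι)) (G ∘ₗ fgradAdj n (liftEquiv (τ ν) ι)))
      (fun y y' => m₀ * θ * Real.exp (-((δ - σ) * g.dist y y'))) := fun ν => hasMaj_exp_mono hd (mul_nonneg hm₀ hθ) (by linarith) (hDS ν)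
  have hSh1 : ∀ μ, HasMaj (BlockNorm.ofBlocks g (liftBlk blk ι)) (BlockNorm.ofBlocks g (liftBlk blk ι)) (pull (liftEquiv (τ μ) ι))
      (fun y y' => cT * Real.exp (-((δ - σ) * g.dist y y'))) := fun μ => hasMaj_exp_mono hd hcT (by linarith) (hSh μ)
  have hSh1' : ∀ μ, HasMaj (BlockNorm.ofBlocks g (liftBlk (blk ∘ π) ι)) (BlockNorm.ofBlocks g (liftBlk (blk ∘ π) ι)) (pull (liftEquiv (τ' μ) ι))
      (fun y y' => cT * Real.exp (-((δ - σ) * g.dist y y'))) := fun μ => hasMaj_exp_mono hd hcT (by linarith) (hSh' μ)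
  have hDSh1 : ∀ μ, HasMaj (BlockNorm.ofBlocks g (liftBlk (liftBlk blk ι) J)) (BlockNorm.ofBlocks g (liftBlk (blk ∘ π) ι))
      (idef (pull (liftMap π ι)) (pull (liftMap π ι)) (pull (liftEquiv (τ' μ) ι)) (pull (liftEquiv (τ μ) ι)) ∘ₗ
        (mmulOp (A (Sum.inl μ) ∘ ⇑(τ μ).symm) ∘ₗ sumJ fun ν => G ∘ₗ fgradAdj n (liftEquiv (τ ν) ι)))
      (fun y y' => mT * θ * Real.exp (-((δ - σ) * g.dist y y'))) := fun μ => hasMaj_exp_mono hd (mul_nonneg hmT hθ) (by linarith) (hDSh μ)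
  have hq2' : 1 * rowConst (Fintype.card J) β cT a cr * cr * cr < 1 := by linarith
  -- FILE 3 ★★ at rate `δ − σ`, final rate `δ − 6σ`, the `C^b` slots LIVE
  have hC0 : 0 ≤ bgConst β cr m₀ (1 + Fintype.card (J ⊕ J)) a := bgConst_nonneg hβ hcr hm₀ hJ0 ha
  have key := hasMaj_idef_entry2_of_letters (liftBlk blk ι) (liftMap π ι) htri hd hd0 hrow hσ hcr (δ := δ - σ) (ρ := δ - 6 * σ) (by linarith) (by linarith) hβ
    (by positivity) hR0 hcT ha (mul_nonneg hm₀ hθ) (mul_nonneg hC0 hθ) (mul_nonneg hR0 hθ) (mul_nonneg hmT hθ)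
    hS1 hS1' hE' hR hR' hSh1 hSh1' hCa hCa' hCb hCb' hDS1 hDE hDR hDCa hDCb hDSh1 hq2'
  have hAi : 0 ≤ (1 * (1 - 1 * rowConst (Fintype.card J) β cT a cr * cr * cr))⁻¹ := by
    rw [one_mul]; exact inv_nonneg.2 (by linarith)
  refine ((hasMaj_exp_comp_diagK (b₁ := BlockNorm.ofBlocks g (liftBlk blk ι)) (b₃ := BlockNorm.ofBlocks g (liftBlk (blk ∘ π) ι)) (liftBlk (liftBlk blk ι) J) ?_ key
    (hasMaj_injJ (liftBlk blk ι) ν))).mono ?_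
  · set Ai := (1 * (1 - 1 * rowConst (Fintype.card J) β cT a cr * cr * cr))⁻¹
    set B := bgConst β cr m₀ (1 + (Fintype.card (J ⊕ J) : ℝ)) a
    unfold srcConst mKOf mBOf
    positivity
  · intro y y'
    refine le_of_eq ?_
    rw [bpConst2L, show a * (1 + (Fintype.card (J ⊕ J) : ℝ)) * θ = θ * (a * (1 + Fintype.card (J ⊕ J))) by ring,
      show m₀ * θ = θ * m₀ by ring, show mT * θ = θ * mT by ring,
      show bgConst β cr m₀ (1 + (Fintype.card (J ⊕ J) : ℝ)) a * θ = θ * bgConst β cr m₀ (1 + Fintype.card (J ⊕ J)) a by ring, mKOf_mul, mBOf_mul]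
    ring


end Entry2

end Summit.QuantumFields.YangMills.BalabanUVNodes.N15.BackgroundLayer

end
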